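import Literature.NumberTheory.BeurlingPrimes.WellBehavedSystemsThm31Proofs
import Literature.NumberTheory.BeurlingPrimes.WellBehavedSystemsProofs
import HarnessLib

/-!
# Broucke–Vindas 2024, Theorem 3.1 — the discharge `BrouckeVindas2024_thm31_holds`

Topic `Literature/NumberTheory/BeurlingPrimes`. Everything in this file is PROVED.

The named fact `BrouckeVindas2024_thm31` of `WellBehavedSystems.lean` (F. Broucke, J. Vindas, *A new generalized
prime random approximation procedure and some of its applications*, Math. Z. 307 (2024), Theorem 3.1: "There is a
discrete Beurling generalized prime system `𝒫` such that `Π_𝒫(x) = Li(x) + O(log log x)`,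
`N_𝒫(x) = x + O(x^{1/2} exp(c(log x)^{2/3}))` for some `c > 0`, and `N_𝒫(x) = x + Ω_ε(x^{1/2−ε})` for any
`ε > 0`") is the reduction `BrouckeVindas2024_thm31_of_thm12` (`WellBehavedSystemsThm31Proofs.lean`, the printed
§3 proof) applied to the random approximation theorem `BrouckeVindas2024_thm12_holds`
(`WellBehavedSystemsProofs.lean`, BV Theorem 1.2).

## References
* [BrouckeVindas2024] F. Broucke, J. Vindas, Math. Z. 307 (2024), arXiv:2102.08478, Theorems 1.2 and 3.1 (read).
-/

namespace Literature.NumberTheory.BeurlingPrimes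

/-- **Broucke–Vindas 2024, Theorem 3.1** (the `[0, 1/2]`-system), proved: Theorem 1.2 (`BrouckeVindas2024_thm12_holds`)
fed into the §3 argument (`BrouckeVindas2024_thm31_of_thm12`). [cite: BrouckeVindas2024, Theorem 3.1] -/
theorem BrouckeVindas2024_thm31_holds : BrouckeVindas2024_thm31 :=
  BrouckeVindas2024_thm31_of_thm12 BrouckeVindas2024_thm12_holds

end Literature.NumberTheory.BeurlingPrimes
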